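import Summits.BirchSwinnertonDyer.Uniform.UI.O2UnitAxis
import HarnessLib

/-!
# Uniform/UI/O2 — the unit `U(P)` along the Mordell–Weil lattice: quadratic law and the
# ONE-POINT radical form of C4 in rank one

HONEST FRAMING (cell `bsd-uniform`, seat `ui-o2`, gen 7; companion of `O2UnitAxis.lean`): THEOREMS
ONLY about the objects of `Uniform/UI/O2.lean`; no definition, no named fact, no `sorry`; the
conjecture `TateSigmaIrrationalAtThree` ("C4") is assumed nowhere and stays OPEN; nothing here proves
BSD for any curve, books anything or moves a census mark (PLAN D7: no compute, no route, no statement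
change).

Write `U(P) = Σ²_E(P)/den x(P) ∈ ℤ₃ˣ` (gen 5), `ĥ₃(P) = −log₃ U(P)`. Since THE §4.2 height datum `Dh`
(`IsMultCanonical Dh q`) is a symmetric bilinear torsion-vanishing pairing whose quadratic form on
admissible points is `ĥ₃`, and `ker log₃ ∩ ℤ₃ˣ = {±1}` (`O2UnitAxis`, §0), the VALUES of the
conjecture's object along the lattice `E(ℚ)` are rigid:

* §1 **quadratic law** `tateSigmaValueSq_div_den_nsmul`: for admissible `P` and `nP = (x', y')`
  admissible, **`U(nP) = ±U(P)^{n²}`**; **torsion translation** `tateSigmaValueSq_div_den_add_torsion`: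
  `U(P + T) = ±U(P)` for torsion `T`. Consequences: a RATIONAL `Σ²_E(P)` (a counterexample to C4 at
  `P`) propagates to every admissible multiple (`exists_ratCast_eq_tateSigmaValueSq_nsmul`), and
  membership in `ℚ̄` is CONSTANT along multiple-chains (`isAlgebraic_tateSigmaValueSq_nsmul_iff`: the
  strong form C4⁺ at `P` ⟺ at `nP`). READING for the evidence ledger (`O2-CONJECTURE.md` §4, §8): the
  σ-screens P1/P1′ tested `Σ²` at `Q, 2Q, 3Q` per register row — by the quadratic law these probe
  `U, U⁴, U⁹` of ONE unit, so the three values are NOT independent trials (a hit at `Q` forces hits at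
  `2Q, 3Q`); the honest count of independent units screened is the number of ROWS (2 020 + 4 054), not
  of values.
* §2 **pointwise radical dictionary**: `Σ²_E(P)^k ∈ ℚ` for some `k ≥ 1` ⟺ `ĥ₃(P) ∈ ℚ·log₃(ℚˣ)`
  (`exists_pow_tateSigmaValueSq_eq_ratCast_of_height_eq_ratMul_padicLog`,
  `exists_height_eq_ratMul_padicLog_of_pow_tateSigmaValueSq_eq_ratCast`).
* §3 **ONE POINT DECIDES C4 ON A RANK-ONE CURVE** (`forall_admissible_iff_forall_pow_ne_ratCast`):
  for `W` globally minimal multiplicative at `3` of Mordell–Weil rank one, `‖q‖ < 1`, ANY datum `Dh`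
  with `IsMultCanonical Dh q`, and ANY ONE admissible point `P₁`:
  **«`Σ²_E(Q) ∉ ℚ` for every admissible `Q`» ⟺ «no power `Σ²_E(P₁)^k` (`k ≥ 1`) is rational»**,
  i.e. C4 on the curve is the statement that the single unit `U(P₁)` is not a RADICAL of a rational
  number. (Gen 4's regulator form said `Reg₃ ∉ ℚ·log₃(ℚˣ)`; this is its exponentiated, one-point
  version. Next to `O2UnitAxis` §2 — the certificate is `U(P₁) ∉ {±1}` at one point — the two inputs
  of the lever road on O2 now read, per curve, as two properties of ONE explicit `3`-adic unit.)
  On the non-split locus THE datum exists (`exists_isMultCanonical_holds`):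
  `forall_admissible_iff_forall_pow_ne_ratCast_nonsplit`.

References: [SteinWuthrich2013] §4.1 eq. (4.1), §4.2; [MazurSteinTate2006] §1 (`h_p(nQ) = n² h_p(Q)`),
Conj. 1.1; [Schneider1982PadicHeightI] §1; [Bertrand1982] Cor. 4, Problème 1; [Iwasawa1972PadicL]
§4.4; write-up `HOME/ui/O2-CONJECTURE.md` §12.
-/

noncomputable section

open scoped Classical

namespace Summit.BirchSwinnertonDyer.Uniform.UI.O2

open WeierstrassCurve Literature.NumberTheory.EllipticCurves
open Literature.NumberTheory.EllipticCurves.SteinWuthrich2013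
open Literature.NumberTheory.EllipticCurves.Rank1Residual Summit.BirchSwinnertonDyer.Rank1Residual

variable {W : WeierstrassCurve ℚ}

/-! ### §1 The quadratic law `U(nP) = ±U(P)^{n²}` and torsion translation -/

/-- **Equal heights ⟹ equal units up to sign.** For `W` globally minimal multiplicative at `3`,
`‖q‖ < 1`, and two rational points `P = (x, y)`, `P' = (x', y')` with `‖x‖₃, ‖x'‖₃ > 1`: if
`ĥ₃(P') = m · ĥ₃(P)` for a natural number `m`, then `U(P') = ±U(P)^m` (`ĥ = −log₃ U`, `log₃` of a
power, and `ker log₃ ∩ ℤ₃ˣ = {±1}`). [cite: SteinWuthrich2013, §4.2] [cite: Iwasawa1972PadicL, §4.4] -/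
theorem tateSigmaValueSq_div_den_eq_or_eq_neg_pow_of_height_eq_mul [W.IsElliptic]
    [W.IsGloballyMinimal] (hW : Mult W 3) {q : ℚ_[3]} (hq : ‖q‖ < 1) {x y x' y' : ℚ}
    (hxy : W.toAffine.Nonsingular x y) (hx : 1 < ‖(x : ℚ_[3])‖)
    (hxy' : W.toAffine.Nonsingular x' y') (hx' : 1 < ‖(x' : ℚ_[3])‖) {m : ℕ}
    (hh : heightFourOneCoord W 3 q x' y' = (m : ℚ_[3]) * heightFourOneCoord W 3 q x y) :
    tateSigmaValueSq W 3 q x' y' / ((x'.den : ℚ) : ℚ_[3]) =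
        (tateSigmaValueSq W 3 q x y / ((x.den : ℚ) : ℚ_[3])) ^ m ∨
      tateSigmaValueSq W 3 q x' y' / ((x'.den : ℚ) : ℚ_[3]) =
        -(tateSigmaValueSq W 3 q x y / ((x.den : ℚ) : ℚ_[3])) ^ m := by
  set U : ℚ_[3] := tateSigmaValueSq W 3 q x y / ((x.den : ℚ) : ℚ_[3]) with hU_def
  set U' : ℚ_[3] := tateSigmaValueSq W 3 q x' y' / ((x'.den : ℚ) : ℚ_[3]) with hU'_def
  have hU1 : ‖U‖ = 1 := norm_tateSigmaValueSq_div_den_eq_one (p := 3) (by decide) hW hq hxy hx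
  have hU'1 : ‖U'‖ = 1 := norm_tateSigmaValueSq_div_den_eq_one (p := 3) (by decide) hW hq hxy' hx'
  have hU0 : U ≠ 0 := norm_pos_iff.mp (by rw [hU1]; exact one_pos)
  have hUm1 : ‖U ^ m‖ = 1 := by rw [norm_pow, hU1, one_pow]
  rw [heightFourOneCoord_eq_neg_padicLog_div_den (p := 3) (by decide) hW hq hxy hx,
    heightFourOneCoord_eq_neg_padicLog_div_den (p := 3) (by decide) hW hq hxy' hx'] at hh
  have hlog : padicLog 3 U' = padicLog 3 (U ^ m) := by
    rw [padicLog_pow_three hU0 m]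
    linear_combination -hh
  exact eq_or_eq_neg_of_norm_eq_one_of_padicLog_eq hU'1 hUm1 hlog

/-- **QUADRATIC LAW.** For `W` globally minimal multiplicative at `3`, `‖q‖ < 1`, a datum `Dh` with
`IsMultCanonical Dh q`, an admissible `P = (x, y)` and a multiple `nP = (x', y')` which is again
admissible: **`U(nP) = U(P)^{n²}` or `U(nP) = −U(P)^{n²}`** (`⟨nP, nP⟩ = n²⟨P, P⟩` and both are the
heights (4.1)). The `3`-adic analogue, for the Tate–sigma value squared, of `σ(nP) = ψ_n(P)σ(P)^{n²}`
up to the rational factor absorbed in `den x`. [cite: MazurSteinTate2006, §1] [cite: SteinWuthrich2013, §4.2] -/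
theorem tateSigmaValueSq_div_den_nsmul [W.IsElliptic] [W.IsGloballyMinimal] (hW : Mult W 3)
    {q : ℚ_[3]} (hq : ‖q‖ < 1) {Dh : PAdicHeightData W 3} (hDh : IsMultCanonical Dh q)
    {x y : ℚ} {h : W.toAffine.Nonsingular x y} (hadm : W.IsAdmissible 3 (.some x y h)) {n : ℕ}
    {x' y' : ℚ} {h' : W.toAffine.Nonsingular x' y'}
    (hmul : n • (.some x y h : W.toAffine.Point) = .some x' y' h')
    (hadm' : W.IsAdmissible 3 (.some x' y' h')) :
    tateSigmaValueSq W 3 q x' y' / ((x'.den : ℚ) : ℚ_[3]) =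
        (tateSigmaValueSq W 3 q x y / ((x.den : ℚ) : ℚ_[3])) ^ (n ^ 2) ∨
      tateSigmaValueSq W 3 q x' y' / ((x'.den : ℚ) : ℚ_[3]) =
        -(tateSigmaValueSq W 3 q x y / ((x.den : ℚ) : ℚ_[3])) ^ (n ^ 2) := by
  refine tateSigmaValueSq_div_den_eq_or_eq_neg_pow_of_height_eq_mul hW hq h hadm.2.1 h' hadm'.2.1 ?_
  have h1 : Dh.pairing (.some x' y' h') (.some x' y' h') = heightFourOneCoord W 3 q x' y' :=
    hDh _ hadm'
  have h2 : Dh.pairing (.some x y h) (.some x y h) = heightFourOneCoord W 3 q x y := hDh _ hadm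
  rw [← h1, ← h2, ← hmul, pairing_nsmul_nsmul]
  push_cast
  ring

/-- **TORSION TRANSLATION.** Same setting; for a torsion point `T` with `P + T = (x', y')`
admissible: `U(P + T) = ±U(P)` (`⟨P + T, P + T⟩ = ⟨P, P⟩`). [cite: MazurSteinTate2006, §1]
[cite: SteinWuthrich2013, §4.2] -/
theorem tateSigmaValueSq_div_den_add_torsion [W.IsElliptic] [W.IsGloballyMinimal] (hW : Mult W 3)
    {q : ℚ_[3]} (hq : ‖q‖ < 1) {Dh : PAdicHeightData W 3} (hDh : IsMultCanonical Dh q)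
    {x y : ℚ} {h : W.toAffine.Nonsingular x y} (hadm : W.IsAdmissible 3 (.some x y h))
    {T : W.toAffine.Point} (hT : IsOfFinAddOrder T) {x' y' : ℚ}
    {h' : W.toAffine.Nonsingular x' y'}
    (hsum : (.some x y h : W.toAffine.Point) + T = .some x' y' h')
    (hadm' : W.IsAdmissible 3 (.some x' y' h')) :
    tateSigmaValueSq W 3 q x' y' / ((x'.den : ℚ) : ℚ_[3]) =
        tateSigmaValueSq W 3 q x y / ((x.den : ℚ) : ℚ_[3]) ∨
      tateSigmaValueSq W 3 q x' y' / ((x'.den : ℚ) : ℚ_[3]) =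
        -(tateSigmaValueSq W 3 q x y / ((x.den : ℚ) : ℚ_[3])) := by
  have key := tateSigmaValueSq_div_den_eq_or_eq_neg_pow_of_height_eq_mul hW hq h hadm.2.1 h'
    hadm'.2.1 (m := 1) ?_
  · simpa only [pow_one] using key
  have h1 : Dh.pairing (.some x' y' h') (.some x' y' h') = heightFourOneCoord W 3 q x' y' :=
    hDh _ hadm'
  have h2 : Dh.pairing (.some x y h) (.some x y h) = heightFourOneCoord W 3 q x y := hDh _ hadm
  have hTP : Dh.pairing T (.some x y h) = 0 := Dh.map_torsion _ _ hT
  have hTT : Dh.pairing T T = 0 := Dh.map_torsion _ _ hT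
  have hPT : Dh.pairing (.some x y h) T = 0 := Dh.map_torsion_right _ _ hT
  rw [← h1, ← h2, ← hsum]
  simp only [map_add, AddMonoidHom.add_apply, hTP, hTT, hPT, add_zero, Nat.cast_one, one_mul]

/-- **A rational `Σ²` propagates to every admissible multiple.** If `Σ²_E(P) = r ∈ ℚ` at an
admissible `P` (the event C4 excludes), then `Σ²_E(nP) ∈ ℚ` at every admissible multiple
`nP = (x', y')` (`U(nP) = ±U(P)^{n²}` with `U(P) = r/den x ∈ ℚ`). [cite: SteinWuthrich2013, §4.2] -/
theorem exists_ratCast_eq_tateSigmaValueSq_nsmul [W.IsElliptic] [W.IsGloballyMinimal]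
    (hW : Mult W 3) {q : ℚ_[3]} (hq : ‖q‖ < 1) {Dh : PAdicHeightData W 3}
    (hDh : IsMultCanonical Dh q) {x y : ℚ} {h : W.toAffine.Nonsingular x y}
    (hadm : W.IsAdmissible 3 (.some x y h)) {n : ℕ} {x' y' : ℚ}
    {h' : W.toAffine.Nonsingular x' y'}
    (hmul : n • (.some x y h : W.toAffine.Point) = .some x' y' h')
    (hadm' : W.IsAdmissible 3 (.some x' y' h')) {r : ℚ}
    (hr : tateSigmaValueSq W 3 q x y = (r : ℚ_[3])) :
    ∃ r' : ℚ, tateSigmaValueSq W 3 q x' y' = (r' : ℚ_[3]) := by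
  have hd' : ((x'.den : ℚ) : ℚ_[3]) ≠ 0 := by exact_mod_cast x'.den_nz
  rcases tateSigmaValueSq_div_den_nsmul hW hq hDh hadm hmul hadm' with hU | hU
  · refine ⟨(r / x.den) ^ (n ^ 2) * x'.den, ?_⟩
    rw [div_eq_iff hd'] at hU
    rw [hU, hr]
    push_cast
    ring
  · refine ⟨-(r / x.den) ^ (n ^ 2) * x'.den, ?_⟩
    rw [div_eq_iff hd'] at hU
    rw [hU, hr]
    push_cast
    ring

/-- `Σ²_E(P) ∈ ℚ̄ ⟺ U(P) ∈ ℚ̄` (`den x(P) ∈ ℚˣ`). [folklore] -/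
theorem isAlgebraic_tateSigmaValueSq_iff_div_den (W : WeierstrassCurve ℚ) (q : ℚ_[3]) (x y : ℚ) :
    IsAlgebraic ℚ (tateSigmaValueSq W 3 q x y) ↔
      IsAlgebraic ℚ (tateSigmaValueSq W 3 q x y / ((x.den : ℚ) : ℚ_[3])) := by
  have hd : ((x.den : ℚ) : ℚ_[3]) ≠ 0 := by exact_mod_cast x.den_nz
  have hda : IsAlgebraic ℚ ((x.den : ℚ) : ℚ_[3]) := by
    simpa using isAlgebraic_algebraMap (R := ℚ) (A := ℚ_[3]) (x.den : ℚ)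
  constructor
  · intro hS
    exact hS.mul (IsAlgebraic.inv_iff.mpr hda)
  · intro hU
    have : tateSigmaValueSq W 3 q x y =
        tateSigmaValueSq W 3 q x y / ((x.den : ℚ) : ℚ_[3]) * ((x.den : ℚ) : ℚ_[3]) := by
      rw [div_mul_cancel₀ _ hd]
    rw [this]
    exact hU.mul hda

/-- **C4⁺ is constant along multiple-chains.** Same setting as the quadratic law: `Σ²_E(nP) ∈ ℚ̄ ⟺
Σ²_E(P) ∈ ℚ̄` (`U(nP) = ±U(P)^{n²}`, `n ≠ 0` because `nP` is affine; `IsAlgebraic.of_pow`). So the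
strong form `TateSigmaTranscendentalAtThree` holds at an admissible point iff it holds at any of its
admissible multiples. [cite: Bertrand1982, Cor. 2, Problème 1] [cite: SteinWuthrich2013, §4.2] -/
theorem isAlgebraic_tateSigmaValueSq_nsmul_iff [W.IsElliptic] [W.IsGloballyMinimal] (hW : Mult W 3)
    {q : ℚ_[3]} (hq : ‖q‖ < 1) {Dh : PAdicHeightData W 3} (hDh : IsMultCanonical Dh q)
    {x y : ℚ} {h : W.toAffine.Nonsingular x y} (hadm : W.IsAdmissible 3 (.some x y h)) {n : ℕ}
    {x' y' : ℚ} {h' : W.toAffine.Nonsingular x' y'}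
    (hmul : n • (.some x y h : W.toAffine.Point) = .some x' y' h')
    (hadm' : W.IsAdmissible 3 (.some x' y' h')) :
    IsAlgebraic ℚ (tateSigmaValueSq W 3 q x' y') ↔ IsAlgebraic ℚ (tateSigmaValueSq W 3 q x y) := by
  have hn : 0 < n ^ 2 := by
    rcases Nat.eq_zero_or_pos n with rfl | hn
    · rw [zero_nsmul] at hmul
      cases hmul
    · positivity
  rw [isAlgebraic_tateSigmaValueSq_iff_div_den W q x' y', isAlgebraic_tateSigmaValueSq_iff_div_den W q x y]
  rcases tateSigmaValueSq_div_den_nsmul hW hq hDh hadm hmul hadm' with hU | hU <;> rw [hU]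
  · exact ⟨fun hA ↦ hA.of_pow hn, fun hA ↦ hA.pow _⟩
  · refine ⟨fun hA ↦ ?_, fun hA ↦ (hA.pow _).neg⟩
    have := hA.neg
    rw [neg_neg] at this
    exact this.of_pow hn

/-! ### §2 Pointwise radical dictionary: `Σ²^k ∈ ℚ (some k ≥ 1) ⟺ ĥ₃ ∈ ℚ·log₃(ℚˣ)` -/

/-- **(height ⟹ radical).** If `ĥ₃(P) = c · log₃ s` with `c ∈ ℚ`, `s ∈ ℚˣ`, and `Σ²_E(P) ≠ 0`, then
some power `Σ²_E(P)^k`, `k ≥ 1` (namely `k = den c`), is rational: `k·ĥ = num c · log₃ s`, so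
`log₃ Σ²^k = log₃ (den x^k / s^{num c})` and the rational kernel of `log₃` applies. Pure algebra (any
`W`, `q`, `P`). [cite: SteinWuthrich2013, §4.1 eq. (4.1)] [cite: Iwasawa1972PadicL, §4.4] -/
theorem exists_pow_tateSigmaValueSq_eq_ratCast_of_height_eq_ratMul_padicLog (W : WeierstrassCurve ℚ)
    (q : ℚ_[3]) {x y : ℚ} (hS0 : tateSigmaValueSq W 3 q x y ≠ 0) {c s : ℚ} (hs : s ≠ 0)
    (hh : heightFourOneCoord W 3 q x y = (c : ℚ_[3]) * padicLog 3 (s : ℚ_[3])) :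
    ∃ k : ℕ, 0 < k ∧ ∃ r : ℚ, tateSigmaValueSq W 3 q x y ^ k = (r : ℚ_[3]) := by
  set S : ℚ_[3] := tateSigmaValueSq W 3 q x y with hS_def
  have hd0 : ((x.den : ℚ) : ℚ_[3]) ≠ 0 := by exact_mod_cast x.den_nz
  have hs3 : (s : ℚ_[3]) ≠ 0 := by exact_mod_cast hs
  have hden : (x.den : ℚ) ≠ 0 := by exact_mod_cast x.den_nz
  refine ⟨c.den, c.den_pos, ?_⟩
  -- the rational `t = den x ^ den c / s ^ num c`
  set t : ℚ := (x.den : ℚ) ^ c.den / s ^ c.num with ht_def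
  have ht0 : t ≠ 0 := div_ne_zero (pow_ne_zero _ hden) (zpow_ne_zero _ hs)
  have hSk0 : S ^ c.den ≠ 0 := pow_ne_zero _ hS0
  have hcnum : ((c.den : ℚ) : ℚ_[3]) * (c : ℚ_[3]) = ((c.num : ℚ) : ℚ_[3]) := by
    rw [← Rat.cast_mul, mul_comm, Rat.mul_den_eq_num]
  have hh' : padicLog 3 ((x.den : ℚ) : ℚ_[3]) - padicLog 3 S =
      (c : ℚ_[3]) * padicLog 3 (s : ℚ_[3]) := by
    rw [← hh]; rfl
  have hlog : padicLog 3 (S ^ c.den) = padicLog 3 (t : ℚ_[3]) := by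
    have ht : (t : ℚ_[3]) = ((x.den : ℚ) : ℚ_[3]) ^ c.den * ((s : ℚ_[3]) ^ c.num)⁻¹ := by
      rw [ht_def]; push_cast; ring
    rw [ht, padicLog_mul_holds 3 (pow_ne_zero _ hd0) (inv_ne_zero (zpow_ne_zero _ hs3)),
      padicLog_inv_three (zpow_ne_zero _ hs3), padicLog_pow_three hS0, padicLog_pow_three hd0,
      padicLog_zpow_three hs3]
    have : ((c.den : ℚ_[3])) * (c : ℚ_[3]) = ((c.num : ℤ) : ℚ_[3]) := by exact_mod_cast hcnum
    linear_combination (c.den : ℚ_[3]) * hh'.symm - padicLog 3 (s : ℚ_[3]) * this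
  exact exists_ratCast_eq_of_padicLog_eq_padicLog_ratCast hSk0 ht0 hlog

/-- **(radical ⟹ height).** If `Σ²_E(P)^k = r ∈ ℚ` with `k ≥ 1` and `Σ²_E(P) ≠ 0`, then
`ĥ₃(P) = (1/k) · log₃ (den x^k / r) ∈ ℚ·log₃(ℚˣ)`. [cite: SteinWuthrich2013, §4.1 eq. (4.1)]
[cite: Iwasawa1972PadicL, §4.4] -/
theorem exists_height_eq_ratMul_padicLog_of_pow_tateSigmaValueSq_eq_ratCast
    (W : WeierstrassCurve ℚ) (q : ℚ_[3]) {x y : ℚ} (hS0 : tateSigmaValueSq W 3 q x y ≠ 0)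
    {k : ℕ} (hk : 0 < k) {r : ℚ} (hr : tateSigmaValueSq W 3 q x y ^ k = (r : ℚ_[3])) :
    ∃ c s : ℚ, s ≠ 0 ∧ heightFourOneCoord W 3 q x y = (c : ℚ_[3]) * padicLog 3 (s : ℚ_[3]) := by
  set S : ℚ_[3] := tateSigmaValueSq W 3 q x y with hS_def
  have hd0 : ((x.den : ℚ) : ℚ_[3]) ≠ 0 := by exact_mod_cast x.den_nz
  have hden : (x.den : ℚ) ≠ 0 := by exact_mod_cast x.den_nz
  have hr0 : r ≠ 0 := by
    rintro rfl
    exact pow_ne_zero k hS0 (by rw [hr, Rat.cast_zero])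
  have hr3 : (r : ℚ_[3]) ≠ 0 := by exact_mod_cast hr0
  have hk3 : (k : ℚ_[3]) ≠ 0 := by exact_mod_cast hk.ne'
  refine ⟨1 / k, (x.den : ℚ) ^ k / r, div_ne_zero (pow_ne_zero _ hden) hr0, ?_⟩
  have hh : heightFourOneCoord W 3 q x y = padicLog 3 ((x.den : ℚ) : ℚ_[3]) - padicLog 3 S := rfl
  have hlogr : padicLog 3 (r : ℚ_[3]) = (k : ℚ_[3]) * padicLog 3 S := by
    rw [← hr, padicLog_pow_three hS0 k]
  have ht : (((x.den : ℚ) ^ k / r : ℚ) : ℚ_[3]) = ((x.den : ℚ) : ℚ_[3]) ^ k * (r : ℚ_[3])⁻¹ := by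
    push_cast; ring
  rw [hh, ht, padicLog_mul_holds 3 (pow_ne_zero _ hd0) (inv_ne_zero hr3), padicLog_inv_three hr3,
    padicLog_pow_three hd0 k, hlogr]
  push_cast
  field_simp
  ring

/-! ### §3 Rank one: ONE admissible point decides C4 on the curve -/

/-- **ONE POINT DECIDES C4 ON A RANK-ONE CURVE.** For `W/ℚ` globally minimal with multiplicative
reduction at `3`, of Mordell–Weil rank one, `‖q‖ < 1`, ANY datum `Dh` with `IsMultCanonical Dh q`, and
ANY ONE admissible point `P₁ = (x₁, y₁)`: «`Σ²_E(Q) ∉ ℚ` for EVERY admissible `Q`» (C4 on the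
curve) ⟺ «`Σ²_E(P₁)^k ∉ ℚ` for every `k ≥ 1`» (the unit `U(P₁)` is not a radical of a rational).
(`→`: a rational power puts `ĥ₃(P₁)` in `ℚ·log₃(ℚˣ)` (§2), contradicting gen 4's span form
`pairing_self_ne_ratMul_padicLog_of_forall_admissible`. `←`: a rational `Σ²_E(Q)` gives
`ĥ₃(Q) = log₃ s`; in rank one `ĥ₃(P₁) = k₁²Reg₃`, `ĥ₃(Q) = k_Q²Reg₃` with `k_Q ≠ 0`, so
`ĥ₃(P₁) = (k₁/k_Q)² log₃ s` and §2 yields a rational power of `Σ²_E(P₁)`.)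
[cite: SteinWuthrich2013, §4.2] [cite: MazurSteinTate2006, Conj. 1.1] [cite: Bertrand1982, Cor. 4, Problème 1] -/
theorem forall_admissible_iff_forall_pow_ne_ratCast [W.IsElliptic] [W.IsGloballyMinimal]
    (hW : Mult W 3) (hr : W.mordellWeilRank = 1) {q : ℚ_[3]} (hq : ‖q‖ < 1)
    {Dh : PAdicHeightData W 3} (hDh : IsMultCanonical Dh q)
    {x₁ y₁ : ℚ} {h₁ : W.toAffine.Nonsingular x₁ y₁} (hadm₁ : W.IsAdmissible 3 (.some x₁ y₁ h₁)) :
    (∀ (x y : ℚ) (h : W.toAffine.Nonsingular x y), W.IsAdmissible 3 (.some x y h) →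
      ∀ r : ℚ, tateSigmaValueSq W 3 q x y ≠ (r : ℚ_[3])) ↔
    (∀ k : ℕ, 0 < k → ∀ r : ℚ, tateSigmaValueSq W 3 q x₁ y₁ ^ k ≠ (r : ℚ_[3])) := by
  have hS0 : tateSigmaValueSq W 3 q x₁ y₁ ≠ 0 :=
    tateSigmaValueSq_ne_zero (p := 3) (by decide) hW hq h₁ hadm₁.2.1
  constructor
  · intro HW k hk r hkr
    obtain ⟨c, s, hs, hh⟩ :=
      exists_height_eq_ratMul_padicLog_of_pow_tateSigmaValueSq_eq_ratCast W q hS0 hk hkr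
    apply pairing_self_ne_ratMul_padicLog_of_forall_admissible HW hDh hadm₁.1 hs (c := c)
    rw [hDh _ hadm₁]
    exact hh
  · intro H1 x y h hadm r hr'
    obtain ⟨s, hs, hQ⟩ :=
      exists_heightFourOneCoord_eq_padicLog_of_tateSigmaValueSq_eq_ratCast W q x y hr'
    obtain ⟨P₀, -, -, hgen⟩ := exists_generator_of_rank_one hr Dh
    obtain ⟨k₁, hk₁, -⟩ := hgen (.some x₁ y₁ h₁)
    obtain ⟨kQ, hkQ, hkQ0⟩ := hgen (.some x y h)
    have hkQne : (kQ : ℚ_[3]) ≠ 0 := by exact_mod_cast fun h0 ↦ hadm.1 (hkQ0 h0)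
    have e₁ : heightFourOneCoord W 3 q x₁ y₁ = ((k₁ : ℚ_[3]) ^ 2) * Dh.pairing P₀ P₀ := by
      rw [← hk₁]; exact (hDh _ hadm₁).symm
    have eQ : ((kQ : ℚ_[3]) ^ 2) * Dh.pairing P₀ P₀ = padicLog 3 (s : ℚ_[3]) := by
      rw [← hkQ, hDh _ hadm]; exact hQ
    have hh₁ : heightFourOneCoord W 3 q x₁ y₁ =
        (((k₁ : ℚ) ^ 2 / (kQ : ℚ) ^ 2 : ℚ) : ℚ_[3]) * padicLog 3 (s : ℚ_[3]) := by
      rw [e₁, ← eQ]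
      push_cast
      field_simp
    obtain ⟨k, hk, r₁, hr₁⟩ :=
      exists_pow_tateSigmaValueSq_eq_ratCast_of_height_eq_ratMul_padicLog W q hS0 hs hh₁
    exact H1 k hk r₁ hr₁

/-- **On the non-split locus THE datum exists**, so the one-point form holds outright: for `W`
globally minimal, NON-split multiplicative at `3`, of Mordell–Weil rank one, the Tate parameter `q`
(`q ≠ 0`, `‖q‖ < 1`, `j(q) = j(E)`) and any one admissible `P₁`: C4 on the curve ⟺ no power of
`Σ²_E(P₁)` is rational (`exists_isMultCanonical_holds`). Together with `O2UnitAxis`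
(`regulatorNonvanishingAt_three_iff_exists_admissible`: the lever's certificate ⟺ `U(P₁) ≠ ±1`) the
two inputs of the `p = 3` road on pocket O2 are, curve by curve, two nested properties of the single
`3`-adic unit `U(P₁)`: not a root of unity (certificate) / not a radical of a rational (C4).
[cite: SteinWuthrich2013, §4.2 (pp. 15–16)] [cite: Schneider1982PadicHeightI, §1]
[cite: Bertrand1982, Cor. 4, Problème 1] -/
theorem forall_admissible_iff_forall_pow_ne_ratCast_nonsplit [W.IsElliptic] [W.IsGloballyMinimal]
    (hW : Mult W 3) (hns : ¬ W.HasSplitMultiplicativeReductionAtPrime 3)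
    (hr : W.mordellWeilRank = 1) {q : ℚ_[3]} (hq0 : q ≠ 0) (hq : ‖q‖ < 1)
    (hj : tateJ q = (W.j : ℚ_[3])) {x₁ y₁ : ℚ} {h₁ : W.toAffine.Nonsingular x₁ y₁}
    (hadm₁ : W.IsAdmissible 3 (.some x₁ y₁ h₁)) :
    (∀ (x y : ℚ) (h : W.toAffine.Nonsingular x y), W.IsAdmissible 3 (.some x y h) →
      ∀ r : ℚ, tateSigmaValueSq W 3 q x y ≠ (r : ℚ_[3])) ↔
    (∀ k : ℕ, 0 < k → ∀ r : ℚ, tateSigmaValueSq W 3 q x₁ y₁ ^ k ≠ (r : ℚ_[3])) := by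
  obtain ⟨Dh, hDh⟩ := exists_isMultCanonical_holds W 3 (by norm_num) hW hns q hq0 hq hj
  exact forall_admissible_iff_forall_pow_ne_ratCast hW hr hq hDh hadm₁

/-- **Under C4, globally:** for every curve multiplicative at `3`, Tate parameter `q`, and admissible
`P`, NO power `Σ²_E(P)^k` (`k ≥ 1`) is rational — the conjecture of record already carries its
radical strengthening (via its own span form; any rank, THE datum being needed only to pass through
the height: non-split locus). [cite: SteinWuthrich2013, §4.2] [cite: Bertrand1982, Problème 1] -/
theorem pow_tateSigmaValueSq_ne_ratCast_of_tateSigmaIrrational (hC : TateSigmaIrrationalAtThree)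
    (W : WeierstrassCurve ℚ) [W.IsElliptic] [W.IsGloballyMinimal] (hW : Mult W 3)
    (hns : ¬ W.HasSplitMultiplicativeReductionAtPrime 3) {q : ℚ_[3]} (hq0 : q ≠ 0)
    (hq : ‖q‖ < 1) (hj : tateJ q = (W.j : ℚ_[3])) {x y : ℚ} {h : W.toAffine.Nonsingular x y}
    (hadm : W.IsAdmissible 3 (.some x y h)) {k : ℕ} (hk : 0 < k) (r : ℚ) :
    tateSigmaValueSq W 3 q x y ^ k ≠ (r : ℚ_[3]) := by
  intro hkr
  have hC' := hC
  unfold TateSigmaIrrationalAtThree at hC'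
  have HW := hC' W hW q hq0 hq hj
  obtain ⟨Dh, hDh⟩ := exists_isMultCanonical_holds W 3 (by norm_num) hW hns q hq0 hq hj
  have hS0 : tateSigmaValueSq W 3 q x y ≠ 0 :=
    tateSigmaValueSq_ne_zero (p := 3) (by decide) hW hq h hadm.2.1
  obtain ⟨c, s, hs, hh⟩ :=
    exists_height_eq_ratMul_padicLog_of_pow_tateSigmaValueSq_eq_ratCast W q hS0 hk hkr
  apply pairing_self_ne_ratMul_padicLog_of_forall_admissible HW hDh hadm.1 hs (c := c)
  rw [hDh _ hadm]
  exact hh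

end Summit.BirchSwinnertonDyer.Uniform.UI.O2

end
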